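import Literature.MathematicalPhysics.QuantumFieldTheory.Balaban1983to89.B9Eq34CurlGaugeModeWindow
import Literature.MathematicalPhysics.QuantumFieldTheory.Balaban1983to89.B9Eq319QprimeLipschitzTwoBackgrounds

/-!
# `Balaban1983to89.B9Eq34CurlGaugeModeTwoBackgrounds` — T. Bałaban, *Propagators for lattice gauge theories in a background field*, Commun. Math. Phys.
# **99** (1985) 389–434 [Balaban1985BackgroundPropagators] (3.3)–(3.4) p. 391, (3.35)–(3.36) p. 396: **THE PLAQUETTE-HOLONOMY COMMUTATOR — THE CURL OF A
# PURE GAUGE MODE — IS LIPSCHITZ IN THE BACKGROUND, `η`-FREE**: for two unit-bounded backgrounds `U`, `V` with `‖U(b) − V(b)‖ ≤ δη`,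
# `‖U(∂p) − V(∂p)‖ ≤ δη²` and `‖V(∂p) − 1‖ ≤ αη²`, `‖D_U(D_Uλ) − D_V(D_Vλ)‖_{L²} ≤ 2M_φ′M_φ√#{μ<ν}·δ·(1 + 4αη)·‖λ‖_{L²}` — the two-background («(b3)»)
# twin of NE9 leaf-02's `B9Eq34CurlGaugeModeWindow` §1–§3 (there ONE background against its own window: `‖D_U(D_Uλ)‖ ≤ 2M_φ′M_φ√#{μ<ν}·α·‖λ‖`)

statement-level skeleton of published theorems with citation tags; proofs where landed; nothing here is a claim about the Yang–Mills mass gap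

PDF held: `paper:balaban1985-cmp99-background-propagators` (journal page = PDF page + 388), pp. 390–392, 396 — read by this lineage first-hand (p0003–p0004,
p0008) and through the quotations of `B9Eq34CurlGaugeModeWindow` ∕ `B9Eq34CovCurlVector` ∕ `B9Eq310DeltaPrime`.

CITATION HEADER (lean-in-tree rule 2026-08-18).  Audit cell `pub-balaban`, sub-cell `t4`, NE9 crux team (2): LEAF PROVER 04 (`b2b-balaban-t4-ne9-formalise-leaf-04`
gen 78), INTENT-4.  WHY (cell context; DIAGNOSIS D-ne9p1-g87-1 and the OWNER's Δ_π port): the θ-letter of print's slot `π_k†Δ^ηπ_k` (leaf-02's window file +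
the OWNER's `B9Eq3120DeltaPiPrimeFormDiagonal`) pairs the Hessian with pure gauge modes `D_Uλ`; its principal part is the holonomy commutator `D_U(D_Uλ)`.
NE9 compares TWO coupling histories, i.e. two small backgrounds `U`, `V`: the two-background θ-letter `‖⟨u, (Δ′_π,k(U) − Δ′_π,k(V))v⟩‖ = O(δ)` (this
lineage's OFFER O-ne9leaf04-g78-1) needs, term by term, the LIPSCHITZ versions of leaf-02's letters; this file is the first: the commutator's.
CONSUMERS (v1.1, gen 79; doc-only): §4 is read BY NAME by the two-background θ-assembly's supplier
`B9Eq310HessianModePairingTwoBackgrounds.norm_covCurl_covDeriv_sub_le_window₂` ((T3), gen 79), hence by `B9Eq3120DeltaPiPrimeFormTwoBackgrounds`.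

THE PRINT.  p. 391 (3.3)–(3.4): the covariant derivative and curl; p. 392 (verbatim via `B9Ineq369CurvatureSmall`): *«with our assumptions on the configuration
U the operator Δ′ will be a bounded, small operator»*; p. 396 (3.35)–(3.36): the small-field conditions (paraphrase: bounds on the plaquette variables of the
background, `η`-scaled).  Print treats the dependence on the background by analyticity (Thm 3.4 p. 400); the cell reads it as Lipschitz continuity between
two points of the small-field ball.

WHAT IS PROVED (sorry-free; proof lane — no `def`, no `Prop` placeholder; [folklore] algebra of conjugations + norms + the bijective reindexing of leaf-02's §2).
* §1 **`norm_conj_sub_conj_sub_le`** — FOUR unit-bounded units `a, b, a′, b′` and `X`: `‖(aXa⁻¹ − bXb⁻¹) − (a′Xa′⁻¹ − b′Xb′⁻¹)‖ ≤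
  (2‖ab⁻¹ − a′b′⁻¹‖ + 4‖a′b′⁻¹ − 1‖·‖b − b′‖)·‖X‖` (`aXa⁻¹ = h(bXb⁻¹)h⁻¹`, `h = ab⁻¹`; then `hYh⁻¹ − h′Y′h′⁻¹ − (Y − Y′) = (hYh⁻¹ − h′Yh′⁻¹) +
  (h′(Y − Y′)h′⁻¹ − (Y − Y′))` and the two-unitary ∕ one-unitary conjugation letters of `B9Eq319QprimeLipschitz(TwoBackgrounds)`);
  **`norm_AdW_sub_AdW_sub_le`** — the same read on the fibre `W` along `φ` (`M_φ′·(…)·M_φ·‖w‖`); **`norm_mul_sub_mul_le_of_mem_U1`** (`‖U₁U₂ − V₁V₂‖ ≤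
  ‖U₁ − V₁‖ + ‖U₂ − V₂‖`).
* §2 **`covCurl_covDeriv_sub_apply`** (`(D_U(D_Uλ) − D_V(D_Vλ))(p) = c²·[(R(W₁ᵁ) − R(W₂ᵁ)) − (R(W₁ⱽ) − R(W₂ⱽ))]λ(z_p)`) and **`norm_covCurl_covDeriv_sub_le`**:
  under `U(b), V(b) ∈ U1`, `‖U(b) − V(b)‖ ≤ δ₁`, `‖U(∂p) − V(∂p)‖ ≤ δ₂`, `‖V(∂p) − 1‖ ≤ ε`: `‖(…)(p)‖ ≤ ‖c‖²·(M_φ′M_φ)·(2δ₂ + 8εδ₁)·‖λ(z_p)‖`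
  (`h = W₁W₂⁻¹ = U(∂p)` by `B9Eq310DeltaPrime.plaqHolU`'s ordering, as in leaf-02's §1; `‖W₂ᵁ − W₂ⱽ‖ ≤ 2δ₁`).
* §3 **`norm_sq_covCurlL2K_covDerivL2K_sub_le`** ∕ **`norm_covCurlL2K_covDerivL2K_sub_le`**: in `L²` (weight `c₀` on sites, bonds, plaquettes),
  `‖D_U(D_Uλ) − D_V(D_Vλ)‖ ≤ ‖c‖²·(M_φ′M_φ)·(2δ₂ + 8εδ₁)·√#DirPair·‖λ‖` — leaf-02's far-corner counting verbatim on the difference field.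
* §4 **`norm_covCurlL2K_covDerivL2K_sub_le_window`**: at `c = η⁻¹` with `δ₁ = δη`, `δ₂ = δη²`, `ε = αη²`:
  `‖D_U(D_Uλ) − D_V(D_Vλ)‖ ≤ 2(M_φ′M_φ)√#DirPair·δ·(1 + 4αη)·‖λ‖` — `η`-FREE (both powers of `η⁻¹` paid by the closeness ∕ smallness windows).
MODEL ∕ DECLARED READINGS.  (M1)–(M2) of `B9Eq34CurlGaugeModeWindow` (any torus `TSite d Pd`, fibre `W` along `φ`, weight `c₀`, scalar `c`); the bond and
plaquette CLOSENESS windows and `V`'s plaquette window DISPLAYED; no `hRS`, no trace letter (pure transport algebra).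
HONEST SCOPE.  [folklore] conjugation algebra + Cauchy–Schwarz-free counting; FIRST order between two backgrounds (the factor `(1 + 4αη)` is the only
trace of the base point); nothing of [B9] asserted; NOT the two-background θ-letter (its `λ`-letters' Lipschitz continuity and the three-term assembly are
separate storeys); no Hessian pairing here (leaf-02's §4–§5 stay one-background; their two-background reading is the assembly's business).  NOT summit
progress (cell pub-balaban: NE9 NOT PRINTED ∕ NOT PROVED; «NE9 ⇐ the named binders»; row WALLED ON A MODEL (O-NE9-1; NEEDS-COORDINATOR #5 UNRULED); spine
PROVED 0∕9; rung (B)+1 finite T⁴ — NOT infinite volume, NOT mass gap, NOT BetaPertH, NOT Clay).  HONEST DEPENDENCY (cell line): continuum YM on T⁴ ⇐ BetaPertH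
∧ nine spine estimates (0/9 proved); BetaPertH ⇐ (D1) ∧ (D4) ∧ CAP+tail; G-an2-4 gates asym, D1 and NE2/3/4.  NEW file; nothing modified.  Net new unproved
facts: 0.
-/

noncomputable section

open scoped BigOperators InnerProductSpace ComplexConjugate

namespace Literature.MathematicalPhysics.QuantumFieldTheory.Balaban1983to89.B9Eq34CurlGaugeModeTwoBackgrounds

open B4Sect5Torus (TSite)
open B9SectCLatticeCarrier (Bond DirPair shift)
open B7Prop1Explicit (U1 mem_U1)
open B9Eq33CovDerivVector (covDeriv shiftEquiv)
open B9Eq34CovCurlVector (covCurl)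
open B9Eq311L2Pairing (WL2)
open B11Eq103H1Complex (SiteL2K BondL2K covDerivL2K equiv_covDerivL2K)
open B9Eq310HessianOperator (adTransportW PlaqL2K covCurlL2K equiv_covCurlL2K)
open B9Eq328GaugeAction (AdW AdW_apply)
open B9Eq310DeltaPrime (plaqHolU)
open B9Eq319QprimeLipschitz (norm_conj_sub_le_of_mem_U1)
open B9Eq319QprimeLipschitzTwoBackgrounds (norm_conj_sub_conj_le_of_mem_U1)
open B9Ineq369CurvatureSmall (norm_conj_le)
open B9Eq34CurlGaugeModeWindow (covCurl_covDeriv_adTransportW)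
open Finset

variable {d : ℕ} {Pd : Fin d → ℕ}
  {𝔸 : Type*} [NormedRing 𝔸] [NormedAlgebra ℂ 𝔸] [NormOneClass 𝔸]
  {W : Type*} [NormedAddCommGroup W] [InnerProductSpace ℂ W] (φ : W ≃ₗ[ℂ] 𝔸)
  {Mφ Mφ' : ℝ}

/-! ## §1 Conjugation algebra: four transporters -/

omit [NormedAlgebra ℂ 𝔸] in
/-- **`‖U₁U₂ − V₁V₂‖ ≤ ‖U₁ − V₁‖ + ‖U₂ − V₂‖`** for unit-bounded `U₂`, `V₁` (`U₁U₂ − V₁V₂ = (U₁ − V₁)U₂ + V₁(U₂ − V₂)`). [folklore]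
[cite: Balaban1985BackgroundPropagators, p.390] -/
theorem norm_mul_sub_mul_le_of_mem_U1 {U₁ U₂ V₁ V₂ : 𝔸ˣ} (hU₂ : U₂ ∈ U1 𝔸) (hV₁ : V₁ ∈ U1 𝔸) :
    ‖(U₁ : 𝔸) * U₂ - (V₁ : 𝔸) * V₂‖ ≤ ‖(U₁ : 𝔸) - V₁‖ + ‖(U₂ : 𝔸) - V₂‖ := by
  have e : (U₁ : 𝔸) * U₂ - (V₁ : 𝔸) * V₂ = ((U₁ : 𝔸) - V₁) * U₂ + (V₁ : 𝔸) * ((U₂ : 𝔸) - V₂) := by noncomm_ring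
  rw [e]
  refine (norm_add_le _ _).trans (add_le_add ?_ ?_)
  · exact (norm_mul_le _ _).trans (by nlinarith [norm_nonneg ((U₁ : 𝔸) - V₁), (mem_U1.1 hU₂).1])
  · exact (norm_mul_le _ _).trans (by nlinarith [norm_nonneg ((U₂ : 𝔸) - V₂), (mem_U1.1 hV₁).1])

omit [NormedAlgebra ℂ 𝔸] in
/-- **FOUR UNIT-BOUNDED UNITS**: `‖(aXa⁻¹ − bXb⁻¹) − (a′Xa′⁻¹ − b′Xb′⁻¹)‖ ≤ (2‖ab⁻¹ − a′b′⁻¹‖ + 4‖a′b′⁻¹ − 1‖·‖b − b′‖)·‖X‖` — with `h = ab⁻¹`, `Y = bXb⁻¹`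
(`aXa⁻¹ = hYh⁻¹`) and primes: `(hYh⁻¹ − Y) − (h′Y′h′⁻¹ − Y′) = (hYh⁻¹ − h′Yh′⁻¹) + (h′(Y − Y′)h′⁻¹ − (Y − Y′))`, the first by the two-unitary conjugation
letter (`2‖h − h′‖‖Y‖`), the second by the one-unitary letter (`2‖h′ − 1‖‖Y − Y′‖`) and `‖Y − Y′‖ ≤ 2‖b − b′‖‖X‖`. [folklore]
[cite: Balaban1985BackgroundPropagators, p.390, (3.35) p.396] -/
theorem norm_conj_sub_conj_sub_le {a b a' b' : 𝔸ˣ} (ha : a ∈ U1 𝔸) (hb : b ∈ U1 𝔸) (ha' : a' ∈ U1 𝔸) (hb' : b' ∈ U1 𝔸) (X : 𝔸) :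
    ‖((a : 𝔸) * X * ((a⁻¹ : 𝔸ˣ) : 𝔸) - (b : 𝔸) * X * ((b⁻¹ : 𝔸ˣ) : 𝔸)) -
        ((a' : 𝔸) * X * ((a'⁻¹ : 𝔸ˣ) : 𝔸) - (b' : 𝔸) * X * ((b'⁻¹ : 𝔸ˣ) : 𝔸))‖ ≤
      (2 * ‖((a * b⁻¹ : 𝔸ˣ) : 𝔸) - ((a' * b'⁻¹ : 𝔸ˣ) : 𝔸)‖ + 4 * ‖((a' * b'⁻¹ : 𝔸ˣ) : 𝔸) - 1‖ * ‖(b : 𝔸) - (b' : 𝔸)‖) * ‖X‖ := by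
  -- the conjugates `Y = bXb⁻¹`, `Y′ = b′Xb′⁻¹` and the holonomies `h = ab⁻¹`, `h′ = a′b′⁻¹`
  have hh : a * b⁻¹ ∈ U1 𝔸 := (U1 𝔸).mul_mem ha ((U1 𝔸).inv_mem hb)
  have hh' : a' * b'⁻¹ ∈ U1 𝔸 := (U1 𝔸).mul_mem ha' ((U1 𝔸).inv_mem hb')
  have hY : ‖(b : 𝔸) * X * ((b⁻¹ : 𝔸ˣ) : 𝔸)‖ ≤ ‖X‖ := norm_conj_le (mem_U1.1 hb) X
  have hZ : ‖(b : 𝔸) * X * ((b⁻¹ : 𝔸ˣ) : 𝔸) - (b' : 𝔸) * X * ((b'⁻¹ : 𝔸ˣ) : 𝔸)‖ ≤ 2 * ‖(b : 𝔸) - (b' : 𝔸)‖ * ‖X‖ :=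
    norm_conj_sub_conj_le_of_mem_U1 hb hb' X
  have e1 : (a : 𝔸) * X * ((a⁻¹ : 𝔸ˣ) : 𝔸) =
      ((a * b⁻¹ : 𝔸ˣ) : 𝔸) * ((b : 𝔸) * X * ((b⁻¹ : 𝔸ˣ) : 𝔸)) * (((a * b⁻¹)⁻¹ : 𝔸ˣ) : 𝔸) := by
    simp only [mul_inv_rev, inv_inv, Units.val_mul, mul_assoc, Units.inv_mul_cancel_left]
  have e1' : (a' : 𝔸) * X * ((a'⁻¹ : 𝔸ˣ) : 𝔸) =
      ((a' * b'⁻¹ : 𝔸ˣ) : 𝔸) * ((b' : 𝔸) * X * ((b'⁻¹ : 𝔸ˣ) : 𝔸)) * (((a' * b'⁻¹)⁻¹ : 𝔸ˣ) : 𝔸) := by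
    simp only [mul_inv_rev, inv_inv, Units.val_mul, mul_assoc, Units.inv_mul_cancel_left]
  have key : ((a : 𝔸) * X * ((a⁻¹ : 𝔸ˣ) : 𝔸) - (b : 𝔸) * X * ((b⁻¹ : 𝔸ˣ) : 𝔸)) -
        ((a' : 𝔸) * X * ((a'⁻¹ : 𝔸ˣ) : 𝔸) - (b' : 𝔸) * X * ((b'⁻¹ : 𝔸ˣ) : 𝔸)) =
      (((a * b⁻¹ : 𝔸ˣ) : 𝔸) * ((b : 𝔸) * X * ((b⁻¹ : 𝔸ˣ) : 𝔸)) * (((a * b⁻¹)⁻¹ : 𝔸ˣ) : 𝔸) -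
          ((a' * b'⁻¹ : 𝔸ˣ) : 𝔸) * ((b : 𝔸) * X * ((b⁻¹ : 𝔸ˣ) : 𝔸)) * (((a' * b'⁻¹)⁻¹ : 𝔸ˣ) : 𝔸)) +
        (((a' * b'⁻¹ : 𝔸ˣ) : 𝔸) * ((b : 𝔸) * X * ((b⁻¹ : 𝔸ˣ) : 𝔸) - (b' : 𝔸) * X * ((b'⁻¹ : 𝔸ˣ) : 𝔸)) * (((a' * b'⁻¹)⁻¹ : 𝔸ˣ) : 𝔸) -
          ((b : 𝔸) * X * ((b⁻¹ : 𝔸ˣ) : 𝔸) - (b' : 𝔸) * X * ((b'⁻¹ : 𝔸ˣ) : 𝔸))) := by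
    rw [e1, e1']; noncomm_ring
  rw [key]
  have t1 := norm_conj_sub_conj_le_of_mem_U1 hh hh' ((b : 𝔸) * X * ((b⁻¹ : 𝔸ˣ) : 𝔸))
  have t2 := norm_conj_sub_le_of_mem_U1 hh' (le_refl ‖((a' * b'⁻¹ : 𝔸ˣ) : 𝔸) - 1‖)
    ((b : 𝔸) * X * ((b⁻¹ : 𝔸ˣ) : 𝔸) - (b' : 𝔸) * X * ((b'⁻¹ : 𝔸ˣ) : 𝔸))
  have h0 : 0 ≤ ‖((a * b⁻¹ : 𝔸ˣ) : 𝔸) - ((a' * b'⁻¹ : 𝔸ˣ) : 𝔸)‖ := norm_nonneg _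
  have h0' : 0 ≤ ‖((a' * b'⁻¹ : 𝔸ˣ) : 𝔸) - 1‖ := norm_nonneg _
  refine (norm_add_le _ _).trans ((add_le_add t1 t2).trans ?_)
  nlinarith [mul_le_mul_of_nonneg_left hY h0, mul_le_mul_of_nonneg_left hZ h0', norm_nonneg ((b : 𝔸) - (b' : 𝔸)), norm_nonneg X]

/-- **THE FOUR-TRANSPORTER LETTER ON THE FIBRE**: `‖(R(a) − R(b))w − (R(a′) − R(b′))w‖ ≤ M_φ′·(2‖ab⁻¹ − a′b′⁻¹‖ + 4‖a′b′⁻¹ − 1‖·‖b − b′‖)·M_φ·‖w‖`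
(`R(u)w = φ⁻¹(u·φw·u⁻¹)`; §1 on `X = φw`). [cite: Balaban1985BackgroundPropagators, p.390, (3.35) p.396] -/
theorem norm_AdW_sub_AdW_sub_le (hMφ' : 0 ≤ Mφ') (hφ : ∀ w, ‖φ w‖ ≤ Mφ * ‖w‖) (hφ' : ∀ X, ‖φ.symm X‖ ≤ Mφ' * ‖X‖)
    {a b a' b' : 𝔸ˣ} (ha : a ∈ U1 𝔸) (hb : b ∈ U1 𝔸) (ha' : a' ∈ U1 𝔸) (hb' : b' ∈ U1 𝔸) (w : W) :
    ‖(AdW φ a w - AdW φ b w) - (AdW φ a' w - AdW φ b' w)‖ ≤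
      Mφ' * (2 * ‖((a * b⁻¹ : 𝔸ˣ) : 𝔸) - ((a' * b'⁻¹ : 𝔸ˣ) : 𝔸)‖ + 4 * ‖((a' * b'⁻¹ : 𝔸ˣ) : 𝔸) - 1‖ * ‖(b : 𝔸) - (b' : 𝔸)‖) *
        (Mφ * ‖w‖) := by
  have e : (AdW φ a w - AdW φ b w) - (AdW φ a' w - AdW φ b' w) =
      φ.symm (((a : 𝔸) * φ w * ((a⁻¹ : 𝔸ˣ) : 𝔸) - (b : 𝔸) * φ w * ((b⁻¹ : 𝔸ˣ) : 𝔸)) -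
        ((a' : 𝔸) * φ w * ((a'⁻¹ : 𝔸ˣ) : 𝔸) - (b' : 𝔸) * φ w * ((b'⁻¹ : 𝔸ˣ) : 𝔸))) := by
    simp only [AdW_apply, map_sub]
  rw [e]
  have h1 := norm_conj_sub_conj_sub_le ha hb ha' hb' (φ w)
  have hK : 0 ≤ 2 * ‖((a * b⁻¹ : 𝔸ˣ) : 𝔸) - ((a' * b'⁻¹ : 𝔸ˣ) : 𝔸)‖ + 4 * ‖((a' * b'⁻¹ : 𝔸ˣ) : 𝔸) - 1‖ * ‖(b : 𝔸) - (b' : 𝔸)‖ := by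
    positivity
  calc ‖φ.symm _‖ ≤ Mφ' * ‖((a : 𝔸) * φ w * ((a⁻¹ : 𝔸ˣ) : 𝔸) - (b : 𝔸) * φ w * ((b⁻¹ : 𝔸ˣ) : 𝔸)) -
        ((a' : 𝔸) * φ w * ((a'⁻¹ : 𝔸ˣ) : 𝔸) - (b' : 𝔸) * φ w * ((b'⁻¹ : 𝔸ˣ) : 𝔸))‖ := hφ' _
    _ ≤ Mφ' * ((2 * ‖((a * b⁻¹ : 𝔸ˣ) : 𝔸) - ((a' * b'⁻¹ : 𝔸ˣ) : 𝔸)‖ + 4 * ‖((a' * b'⁻¹ : 𝔸ˣ) : 𝔸) - 1‖ * ‖(b : 𝔸) - (b' : 𝔸)‖) *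
        ‖φ w‖) := mul_le_mul_of_nonneg_left h1 hMφ'
    _ ≤ Mφ' * ((2 * ‖((a * b⁻¹ : 𝔸ˣ) : 𝔸) - ((a' * b'⁻¹ : 𝔸ˣ) : 𝔸)‖ + 4 * ‖((a' * b'⁻¹ : 𝔸ˣ) : 𝔸) - 1‖ * ‖(b : 𝔸) - (b' : 𝔸)‖) *
        (Mφ * ‖w‖)) := by gcongr; exact hφ w
    _ = _ := by ring

/-! ## §2 On one plaquette: the difference of the two holonomy commutators -/

omit [NormOneClass 𝔸] in
/-- **`(D_U(D_Uλ) − D_V(D_Vλ))(p_{μν}(x)) = c²·[(R(W₁ᵁ) − R(W₂ᵁ)) − (R(W₁ⱽ) − R(W₂ⱽ))]λ(x + e_μ + e_ν)`** (leaf-02's identity twice).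
[cite: Balaban1985BackgroundPropagators, (3.3)–(3.4) p.391] -/
theorem covCurl_covDeriv_sub_apply (c : ℂ) (U V : Bond d Pd → 𝔸ˣ) (f : TSite d Pd → W) (x : TSite d Pd) (q : DirPair d) :
    covCurl c (adTransportW φ U) (covDeriv c (adTransportW φ U) f) (x, q) - covCurl c (adTransportW φ V) (covDeriv c (adTransportW φ V) f) (x, q) =
      (c * c) • ((AdW φ (U (x, q.1.1) * U (shift q.1.1 x, q.1.2)) (f (shift q.1.2 (shift q.1.1 x))) -
          AdW φ (U (x, q.1.2) * U (shift q.1.2 x, q.1.1)) (f (shift q.1.2 (shift q.1.1 x)))) -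
        (AdW φ (V (x, q.1.1) * V (shift q.1.1 x, q.1.2)) (f (shift q.1.2 (shift q.1.1 x))) -
          AdW φ (V (x, q.1.2) * V (shift q.1.2 x, q.1.1)) (f (shift q.1.2 (shift q.1.1 x))))) := by
  rw [covCurl_covDeriv_adTransportW, covCurl_covDeriv_adTransportW, ← smul_sub]

/-- **THE HOLONOMY COMMUTATOR IS LIPSCHITZ IN THE BACKGROUND, ON ONE PLAQUETTE**: for unit-bounded `U`, `V` with `‖U(b) − V(b)‖ ≤ δ₁`,
`‖U(∂p) − V(∂p)‖ ≤ δ₂`, `‖V(∂p) − 1‖ ≤ ε`: `‖(D_U(D_Uλ) − D_V(D_Vλ))(p)‖ ≤ ‖c‖²·M_φ′·(2δ₂ + 8εδ₁)·M_φ·‖λ(z_p)‖` — §1 with `h = W₁W₂⁻¹ = U(∂p)`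
(`B9Eq310DeltaPrime.plaqHolU`'s ordering) and `‖W₂ᵁ − W₂ⱽ‖ ≤ 2δ₁`. [cite: Balaban1985BackgroundPropagators, (3.3)–(3.4) p.391, (3.35)–(3.36) p.396] -/
theorem norm_covCurl_covDeriv_sub_le (hMφ : 0 ≤ Mφ) (hMφ' : 0 ≤ Mφ') (hφ : ∀ w, ‖φ w‖ ≤ Mφ * ‖w‖) (hφ' : ∀ X, ‖φ.symm X‖ ≤ Mφ' * ‖X‖) (c : ℂ)
    {U V : Bond d Pd → 𝔸ˣ} (hU : ∀ b, U b ∈ U1 𝔸) (hV : ∀ b, V b ∈ U1 𝔸) {δ₁ δ₂ ε : ℝ}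
    (hUV : ∀ b, ‖(U b : 𝔸) - (V b : 𝔸)‖ ≤ δ₁)
    (hpp : ∀ p : B9SectCLatticeCarrier.Plaq d Pd, ‖(plaqHolU U p : 𝔸) - (plaqHolU V p : 𝔸)‖ ≤ δ₂)
    (hplV : ∀ p : B9SectCLatticeCarrier.Plaq d Pd, ‖(plaqHolU V p : 𝔸) - 1‖ ≤ ε) (f : TSite d Pd → W) (x : TSite d Pd) (q : DirPair d) :
    ‖covCurl c (adTransportW φ U) (covDeriv c (adTransportW φ U) f) (x, q) - covCurl c (adTransportW φ V) (covDeriv c (adTransportW φ V) f) (x, q)‖ ≤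
      ‖c‖ ^ 2 * (Mφ' * (2 * δ₂ + 8 * ε * δ₁) * Mφ) * ‖f (shift q.1.2 (shift q.1.1 x))‖ := by
  rw [covCurl_covDeriv_sub_apply, norm_smul, norm_mul, ← sq, mul_assoc]
  refine mul_le_mul_of_nonneg_left ?_ (sq_nonneg _)
  have hWU : (U (x, q.1.1) * U (shift q.1.1 x, q.1.2)) * (U (x, q.1.2) * U (shift q.1.2 x, q.1.1))⁻¹ = plaqHolU U (x, q) := by
    simp only [plaqHolU, mul_inv_rev, mul_assoc]
  have hWV : (V (x, q.1.1) * V (shift q.1.1 x, q.1.2)) * (V (x, q.1.2) * V (shift q.1.2 x, q.1.1))⁻¹ = plaqHolU V (x, q) := by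
    simp only [plaqHolU, mul_inv_rev, mul_assoc]
  refine (norm_AdW_sub_AdW_sub_le φ hMφ' hφ hφ' ((U1 𝔸).mul_mem (hU (x, q.1.1)) (hU (shift q.1.1 x, q.1.2)))
    ((U1 𝔸).mul_mem (hU (x, q.1.2)) (hU (shift q.1.2 x, q.1.1))) ((U1 𝔸).mul_mem (hV (x, q.1.1)) (hV (shift q.1.1 x, q.1.2)))
    ((U1 𝔸).mul_mem (hV (x, q.1.2)) (hV (shift q.1.2 x, q.1.1))) (f (shift q.1.2 (shift q.1.1 x)))).trans ?_
  rw [hWU, hWV]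
  have hε : 0 ≤ ε := (norm_nonneg _).trans (hplV (x, q))
  have hb : ‖((U (x, q.1.2) * U (shift q.1.2 x, q.1.1) : 𝔸ˣ) : 𝔸) - ((V (x, q.1.2) * V (shift q.1.2 x, q.1.1) : 𝔸ˣ) : 𝔸)‖ ≤ 2 * δ₁ := by
    rw [Units.val_mul, Units.val_mul]
    exact (norm_mul_sub_mul_le_of_mem_U1 (hU _) (hV _)).trans (by linarith [hUV (x, q.1.2), hUV (shift q.1.2 x, q.1.1)])
  have hin : 2 * ‖((plaqHolU U (x, q) : 𝔸ˣ) : 𝔸) - ((plaqHolU V (x, q) : 𝔸ˣ) : 𝔸)‖ +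
      4 * ‖((plaqHolU V (x, q) : 𝔸ˣ) : 𝔸) - 1‖ *
        ‖((U (x, q.1.2) * U (shift q.1.2 x, q.1.1) : 𝔸ˣ) : 𝔸) - ((V (x, q.1.2) * V (shift q.1.2 x, q.1.1) : 𝔸ˣ) : 𝔸)‖ ≤ 2 * δ₂ + 8 * ε * δ₁ := by
    have t1 := hpp (x, q)
    have t2 := mul_le_mul (hplV (x, q)) hb (norm_nonneg _) hε
    linarith
  have hw : 0 ≤ Mφ * ‖f (shift q.1.2 (shift q.1.1 x))‖ := by positivity
  calc Mφ' * (2 * ‖((plaqHolU U (x, q) : 𝔸ˣ) : 𝔸) - ((plaqHolU V (x, q) : 𝔸ˣ) : 𝔸)‖ + 4 * ‖((plaqHolU V (x, q) : 𝔸ˣ) : 𝔸) - 1‖ *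
          ‖((U (x, q.1.2) * U (shift q.1.2 x, q.1.1) : 𝔸ˣ) : 𝔸) - ((V (x, q.1.2) * V (shift q.1.2 x, q.1.1) : 𝔸ˣ) : 𝔸)‖) *
        (Mφ * ‖f (shift q.1.2 (shift q.1.1 x))‖)
      ≤ Mφ' * (2 * δ₂ + 8 * ε * δ₁) * (Mφ * ‖f (shift q.1.2 (shift q.1.1 x))‖) :=
        mul_le_mul_of_nonneg_right (mul_le_mul_of_nonneg_left hin hMφ') hw
    _ = Mφ' * (2 * δ₂ + 8 * ε * δ₁) * Mφ * ‖f (shift q.1.2 (shift q.1.1 x))‖ := by ring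

/-! ## §3 In `L²`: every site is the far corner of `#DirPair d` plaquettes (leaf-02's counting on the difference field) -/

variable {c₀ : ℝ} [Fact (0 < c₀)]

/-- **`‖D_U(D_Uλ) − D_V(D_Vλ)‖²_{L²} ≤ (‖c‖²·M_φ′(2δ₂ + 8εδ₁)M_φ)²·#{μ<ν}·‖λ‖²_{L²}`** (weights `c₀` throughout; the translations `shiftEquiv` are bijections).
[cite: Balaban1985BackgroundPropagators, (3.4) p.391, (3.11) p.392, (3.36) p.396] -/
theorem norm_sq_covCurlL2K_covDerivL2K_sub_le (hMφ : 0 ≤ Mφ) (hMφ' : 0 ≤ Mφ') (hφ : ∀ w, ‖φ w‖ ≤ Mφ * ‖w‖) (hφ' : ∀ X, ‖φ.symm X‖ ≤ Mφ' * ‖X‖)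
    (c : ℂ) {U V : Bond d Pd → 𝔸ˣ} (hU : ∀ b, U b ∈ U1 𝔸) (hV : ∀ b, V b ∈ U1 𝔸) {δ₁ δ₂ ε : ℝ}
    (hUV : ∀ b, ‖(U b : 𝔸) - (V b : 𝔸)‖ ≤ δ₁)
    (hpp : ∀ p : B9SectCLatticeCarrier.Plaq d Pd, ‖(plaqHolU U p : 𝔸) - (plaqHolU V p : 𝔸)‖ ≤ δ₂)
    (hplV : ∀ p : B9SectCLatticeCarrier.Plaq d Pd, ‖(plaqHolU V p : 𝔸) - 1‖ ≤ ε) (l : SiteL2K ℂ d Pd c₀ W) :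
    ‖covCurlL2K ℂ c₀ c (adTransportW φ U) (covDerivL2K ℂ c₀ c (adTransportW φ U) l) -
        covCurlL2K ℂ c₀ c (adTransportW φ V) (covDerivL2K ℂ c₀ c (adTransportW φ V) l)‖ ^ 2 ≤
      (‖c‖ ^ 2 * (Mφ' * (2 * δ₂ + 8 * ε * δ₁) * Mφ)) ^ 2 * Fintype.card (DirPair d) * ‖l‖ ^ 2 := by
  have hc₀ : 0 < c₀ := Fact.out
  set K : ℝ := ‖c‖ ^ 2 * (Mφ' * (2 * δ₂ + 8 * ε * δ₁) * Mφ) with hK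
  set lt := WL2.equiv ℂ (fun _ : TSite d Pd => c₀) W l with hlt
  rw [WL2.norm_sq (𝕜 := ℂ) (w := fun _ : B9SectCLatticeCarrier.Plaq d Pd => c₀) (V := W),
    WL2.norm_sq (𝕜 := ℂ) (w := fun _ : TSite d Pd => c₀) (V := W) l]
  have hpt : ∀ p : B9SectCLatticeCarrier.Plaq d Pd,
      c₀ * ‖WL2.equiv ℂ (fun _ : B9SectCLatticeCarrier.Plaq d Pd => c₀) W
        (covCurlL2K ℂ c₀ c (adTransportW φ U) (covDerivL2K ℂ c₀ c (adTransportW φ U) l) -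
          covCurlL2K ℂ c₀ c (adTransportW φ V) (covDerivL2K ℂ c₀ c (adTransportW φ V) l)) p‖ ^ 2 ≤
      c₀ * (K ^ 2 * ‖lt (shift p.2.1.2 (shift p.2.1.1 p.1))‖ ^ 2) := fun p => by
    obtain ⟨x, q⟩ := p
    refine mul_le_mul_of_nonneg_left ?_ hc₀.le
    rw [WL2.equiv_sub, Pi.sub_apply, equiv_covCurlL2K, equiv_covDerivL2K, equiv_covCurlL2K, equiv_covDerivL2K, ← mul_pow]
    exact pow_le_pow_left₀ (norm_nonneg _) (norm_covCurl_covDeriv_sub_le φ hMφ hMφ' hφ hφ' c hU hV hUV hpp hplV _ x q) 2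
  calc ∑ p : B9SectCLatticeCarrier.Plaq d Pd, c₀ * ‖WL2.equiv ℂ (fun _ : B9SectCLatticeCarrier.Plaq d Pd => c₀) W
          (covCurlL2K ℂ c₀ c (adTransportW φ U) (covDerivL2K ℂ c₀ c (adTransportW φ U) l) -
            covCurlL2K ℂ c₀ c (adTransportW φ V) (covDerivL2K ℂ c₀ c (adTransportW φ V) l)) p‖ ^ 2
      ≤ ∑ p : B9SectCLatticeCarrier.Plaq d Pd, c₀ * (K ^ 2 * ‖lt (shift p.2.1.2 (shift p.2.1.1 p.1))‖ ^ 2) :=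
        Finset.sum_le_sum fun p _ => hpt p
    _ = K ^ 2 * ∑ q : DirPair d, ∑ x : TSite d Pd, c₀ * ‖lt (shift q.1.2 (shift q.1.1 x))‖ ^ 2 := by
        rw [Fintype.sum_prod_type, Finset.sum_comm, Finset.mul_sum]
        refine Finset.sum_congr rfl fun q _ => ?_
        rw [Finset.mul_sum]
        exact Finset.sum_congr rfl fun x _ => by ring
    _ = K ^ 2 * ∑ _q : DirPair d, ∑ z : TSite d Pd, c₀ * ‖lt z‖ ^ 2 := by
        congr 1
        refine Finset.sum_congr rfl fun q _ => ?_
        exact Fintype.sum_equiv ((shiftEquiv q.1.1).trans (shiftEquiv q.1.2)) _ _ fun x => rfl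
    _ = K ^ 2 * Fintype.card (DirPair d) * ∑ z : TSite d Pd, c₀ * ‖lt z‖ ^ 2 := by
        rw [Finset.sum_const, Finset.card_univ, nsmul_eq_mul]; ring

/-- **THE HOLONOMY COMMUTATOR IS LIPSCHITZ IN THE BACKGROUND, IN `L²`**: `‖D_U(D_Uλ) − D_V(D_Vλ)‖ ≤ ‖c‖²·M_φ′(2δ₂ + 8εδ₁)M_φ·√#{μ<ν}·‖λ‖`.
[cite: Balaban1985BackgroundPropagators, (3.4) p.391, (3.36) p.396] -/
theorem norm_covCurlL2K_covDerivL2K_sub_le (hMφ : 0 ≤ Mφ) (hMφ' : 0 ≤ Mφ') (hφ : ∀ w, ‖φ w‖ ≤ Mφ * ‖w‖) (hφ' : ∀ X, ‖φ.symm X‖ ≤ Mφ' * ‖X‖)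
    (c : ℂ) {U V : Bond d Pd → 𝔸ˣ} (hU : ∀ b, U b ∈ U1 𝔸) (hV : ∀ b, V b ∈ U1 𝔸) {δ₁ δ₂ ε : ℝ} (hδ₁ : 0 ≤ δ₁) (hδ₂ : 0 ≤ δ₂) (hε : 0 ≤ ε)
    (hUV : ∀ b, ‖(U b : 𝔸) - (V b : 𝔸)‖ ≤ δ₁)
    (hpp : ∀ p : B9SectCLatticeCarrier.Plaq d Pd, ‖(plaqHolU U p : 𝔸) - (plaqHolU V p : 𝔸)‖ ≤ δ₂)
    (hplV : ∀ p : B9SectCLatticeCarrier.Plaq d Pd, ‖(plaqHolU V p : 𝔸) - 1‖ ≤ ε) (l : SiteL2K ℂ d Pd c₀ W) :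
    ‖covCurlL2K ℂ c₀ c (adTransportW φ U) (covDerivL2K ℂ c₀ c (adTransportW φ U) l) -
        covCurlL2K ℂ c₀ c (adTransportW φ V) (covDerivL2K ℂ c₀ c (adTransportW φ V) l)‖ ≤
      ‖c‖ ^ 2 * (Mφ' * (2 * δ₂ + 8 * ε * δ₁) * Mφ) * Real.sqrt (Fintype.card (DirPair d)) * ‖l‖ := by
  have h := norm_sq_covCurlL2K_covDerivL2K_sub_le φ hMφ hMφ' hφ hφ' c hU hV hUV hpp hplV l
  refine (pow_le_pow_iff_left₀ (norm_nonneg _) (by positivity) two_ne_zero).1 (h.trans_eq ?_)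
  rw [show (‖c‖ ^ 2 * (Mφ' * (2 * δ₂ + 8 * ε * δ₁) * Mφ) * Real.sqrt (Fintype.card (DirPair d)) * ‖l‖) ^ 2 =
      (‖c‖ ^ 2 * (Mφ' * (2 * δ₂ + 8 * ε * δ₁) * Mφ)) ^ 2 * (Real.sqrt (Fintype.card (DirPair d))) ^ 2 * ‖l‖ ^ 2 by ring,
    Real.sq_sqrt (Nat.cast_nonneg _)]

/-! ## §4 At the chain's windows: `c = η⁻¹`, `δ₁ = δη`, `δ₂ = δη²`, `ε = αη²` — the bound is `η`-FREE -/

/-- **`‖D_U(D_Uλ) − D_V(D_Vλ)‖_{L²} ≤ 2M_φ′M_φ√#{μ<ν}·δ·(1 + 4αη)·‖λ‖_{L²}` — THE CURL OF A PURE GAUGE MODE IS LIPSCHITZ IN THE BACKGROUND, UNIFORMLY IN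
THE LATTICE SPACING**: at the scalar `η⁻¹` of (3.3)–(3.4), the bond closeness `‖U(b) − V(b)‖ ≤ δη`, the plaquette closeness `‖U(∂p) − V(∂p)‖ ≤ δη²` and
`V`'s plaquette window `‖V(∂p) − 1‖ ≤ αη²`, the two powers of `η⁻¹` are paid by the windows (`η⁻²·(2δη² + 8αη²·δη) = 2δ(1 + 4αη)`).
[cite: Balaban1985BackgroundPropagators, (3.3)–(3.4) p.391, (3.35)–(3.36) p.396] -/
theorem norm_covCurlL2K_covDerivL2K_sub_le_window (hMφ : 0 ≤ Mφ) (hMφ' : 0 ≤ Mφ') (hφ : ∀ w, ‖φ w‖ ≤ Mφ * ‖w‖)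
    (hφ' : ∀ X, ‖φ.symm X‖ ≤ Mφ' * ‖X‖) {η : ℝ} (hη : 0 < η) {U V : Bond d Pd → 𝔸ˣ} (hU : ∀ b, U b ∈ U1 𝔸) (hV : ∀ b, V b ∈ U1 𝔸)
    {α δ : ℝ} (hα : 0 ≤ α) (hδ : 0 ≤ δ)
    (hUV : ∀ b, ‖(U b : 𝔸) - (V b : 𝔸)‖ ≤ δ * η)
    (hpp : ∀ p : B9SectCLatticeCarrier.Plaq d Pd, ‖(plaqHolU U p : 𝔸) - (plaqHolU V p : 𝔸)‖ ≤ δ * η ^ 2)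
    (hplV : ∀ p : B9SectCLatticeCarrier.Plaq d Pd, ‖(plaqHolU V p : 𝔸) - 1‖ ≤ α * η ^ 2) (l : SiteL2K ℂ d Pd c₀ W) :
    ‖covCurlL2K ℂ c₀ ((η : ℂ))⁻¹ (adTransportW φ U) (covDerivL2K ℂ c₀ ((η : ℂ))⁻¹ (adTransportW φ U) l) -
        covCurlL2K ℂ c₀ ((η : ℂ))⁻¹ (adTransportW φ V) (covDerivL2K ℂ c₀ ((η : ℂ))⁻¹ (adTransportW φ V) l)‖ ≤
      2 * (Mφ' * Mφ) * Real.sqrt (Fintype.card (DirPair d)) * δ * (1 + 4 * α * η) * ‖l‖ := by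
  have h := norm_covCurlL2K_covDerivL2K_sub_le φ hMφ hMφ' hφ hφ' ((η : ℂ))⁻¹ hU hV (by positivity : 0 ≤ δ * η) (by positivity : 0 ≤ δ * η ^ 2)
    (by positivity : 0 ≤ α * η ^ 2) hUV hpp hplV l
  have hn : ‖((η : ℂ))⁻¹‖ ^ 2 = (η ^ 2)⁻¹ := by
    rw [norm_inv, Complex.norm_real, Real.norm_eq_abs, inv_pow, sq_abs]
  refine h.trans_eq ?_
  rw [hn]
  field_simp
  ring

end Literature.MathematicalPhysics.QuantumFieldTheory.Balaban1983to89.B9Eq34CurlGaugeModeTwoBackgrounds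

end
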